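import Literature.Barriers.CriticalPhenomena.RigorousRGSmallParameterScalingFunctionRegularity
import Literature.Barriers.CriticalPhenomena.RigorousRGSmallParameterPerturbativeCoefficients
import HarnessLib

/-!
# `RigorousRGSmallParameter` (Slade, Theorem 1.4.1): the increments of `c₀(y, m²L^{αi})` across
# the mass scale — (10.51) of the proof of Lemma 5.2.3

Thirteenth file of the §10.3–§10.4 layer; the mass-scale input of the massive case of Lemma 5.2.3.
G. Slade, *Critical exponents for long-range `O(n)` models below the upper critical dimension*,
Commun. Math. Phys. **358** (2018), §10.4, proof of Lemma 5.2.3: "Let `q_i = c₀(0,m²L^{αi})`. … By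
definition of the mass scale `j_m`, `m²L^{αi} ≍ L^{α(i-j_m)}`. By Lemma 10.3.2, (10.51)
`|q_i - q_{i+1}| ≲ 𝟙_{i≤j_m}L^{-zα(j_m-i)} + 𝟙_{i+1>j_m}L^{-2α(i-j_m)}`."

Here with the tree's mass scale `massScale L α m²` (`RigorousRGSmallParameterFlowExponent`: the
smallest `j` with `m²L^{α(j-1)} ≥ 1`, so that `L^α ≤ m²(L^{j_m})^α ≤ L^{2α}` for `0 < m² ≤ 1` by
`Slade2017_massScale_bounds`), the rescaled masses `A_i = m²(L^i)^α` (the second argument of `c₀`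
at scale `i` in Lemma 10.3.1), and Lemma 10.3.2 (`FRD.Slade2017_lem1032`); the bound is uniform in
the spatial argument `y` (so it applies to `q_i` at `y = 0` and, integrated over the unit cube, to
`Q_i = ∫c₀(y,A_i)dy`). The exponent `z` is shrunk to satisfy `zα ≤ (d-α)/2` ("with `z` reduced if
necessary to ensure that `zα < d-α`").

## What this file proves (everything; no definition, no named fact)

* `FRD.massArg_massScale_bounds` (`L^α ≤ m²(L^{j_m})^α ≤ L^{2α}`), `FRD.massArg_eq`
  (`m²(L^i)^α = m²(L^{j_m})^αL^{α(i-j_m)}`).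
* three linear-arithmetic helpers.
* **`FRD.abs_cZero_massArg_sub_le`** — **(10.51), PROVED uniformly in `y`**: there are `z > 0`
  (`zα ≤ (d-α)/2`) and `C_q` with, for `0 < m² ≤ 1`, all `y`, `i`:
  `|c₀(y,A_i) - c₀(y,A_{i+1})| ≤ C_q(L^{j_m-i})^{-zα}` if `i ≤ j_m`, and `≤ C_q(L^{i-j_m})^{-2α}` if
  `i ≥ j_m`.
* `FRD.abs_integral_cZero_sub_le` — a uniform pointwise bound integrates to the same bound for
  `∫c₀(y,·)dy` (support in the unit cube).
-/

noncomputable section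

namespace Literature.Barriers.CriticalPhenomena

open _root_.MeasureTheory Set Filter
open scoped _root_.Topology Real

namespace LongRangePhi4

namespace FRD

open Literature.Probability.LatticeModels

variable {d : ℕ}

/-! ### The rescaled masses `A_i = m²(L^i)^α` around the mass scale `j_m` -/

/-- **The rescaled mass at the mass scale is of order one**: `L^α ≤ m²(L^{j_m})^α ≤ L^{2α}` for
`0 < m² ≤ 1`, `L > 1`, `α > 0` ("`m²L^{αi} ≍ L^{α(i-j_m)}` by definition of the mass scale `j_m`").
[cite: Slade2017, §3.4 (the mass scale) and Lemma 5.2.3 (proof: "By definition of the mass scale j_m, m²L^{αi} ≍ L^{α(i-j_m)}")] -/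
theorem massArg_massScale_bounds {L α m2 : ℝ} (hL : 1 < L) (hα : 0 < α) (hm : 0 < m2) (hm1 : m2 ≤ 1) :
    L ^ α ≤ m2 * (L ^ massScale L α m2) ^ α ∧ m2 * (L ^ massScale L α m2) ^ α ≤ L ^ (2 * α) := by
  have hL0 : 0 < L := by linarith
  obtain ⟨h1, h2⟩ := Slade2017_massScale_bounds hL hα hm hm1
  have e : (L ^ massScale L α m2 : ℝ) ^ α = (L ^ (-(α * massScale L α m2)))⁻¹ := by
    rw [← Real.rpow_natCast, ← Real.rpow_mul hL0.le, Real.rpow_neg hL0.le, inv_inv, mul_comm]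
  have hp : 0 < L ^ (-(α * massScale L α m2)) := Real.rpow_pos_of_pos hL0 _
  rw [e]
  constructor
  · -- `L^{-αj_m} ≤ L^{-α}m²`
    rw [le_mul_inv_iff₀ hp]
    calc L ^ α * L ^ (-(α * massScale L α m2)) ≤ L ^ α * (L ^ (-α) * m2) := mul_le_mul_of_nonneg_left h1 (by positivity)
      _ = m2 := by rw [← mul_assoc, ← Real.rpow_add hL0]; simp
  · -- `L^{-2α}m² ≤ L^{-αj_m}`
    rw [mul_inv_le_iff₀ hp]
    calc m2 = L ^ (2 * α) * (L ^ (-(2 * α)) * m2) := by rw [← mul_assoc, ← Real.rpow_add hL0]; simp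
      _ ≤ L ^ (2 * α) * L ^ (-(α * massScale L α m2)) := mul_le_mul_of_nonneg_left h2 (by positivity)

/-- `m²(L^i)^α = (m²(L^{j_m})^α) L^{α(i-j_m)}` (real exponent). [cite: Slade2017, Lemma 5.2.3 (proof)] -/
theorem massArg_eq {L : ℝ} (hL : 0 < L) (α m2 : ℝ) (i J : ℕ) :
    m2 * (L ^ i) ^ α = m2 * (L ^ J) ^ α * L ^ (α * ((i : ℝ) - J)) := by
  rw [← Real.rpow_natCast L i, ← Real.rpow_natCast L J, ← Real.rpow_mul hL.le, ← Real.rpow_mul hL.le,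
    mul_assoc, ← Real.rpow_add hL]
  congr 2; ring

/-- Linear arithmetic helper. [folklore] -/
theorem neg_le_mul_of_neg_one_le {α x : ℝ} (hα : 0 ≤ α) (hx : -1 ≤ x) : -α ≤ α * x := by nlinarith

/-- Linear arithmetic helper. [folklore] -/
theorem neg_two_mul_le {c x : ℝ} (hc : 0 ≤ c) (hx : x ≤ 2) : -(2 * c) ≤ -c * x := by nlinarith

/-- Linear arithmetic helper. [folklore] -/
theorem mul_le_three_mul {α x : ℝ} (hα : 0 ≤ α) (hx : x ≤ 3) : α * x ≤ 3 * α := by nlinarith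

/-- **The increments `|c₀(y,m²L^{αi}) - c₀(y,m²L^{α(i+1)})|` across the mass scale** (Lemma 10.3.2
combined with `m²L^{αi} ≍ L^{α(i-j_m)}`): there are `z > 0` (with `zα ≤ (d-α)/2`) and `C_q` such
that for `0 < m² ≤ 1`, all `y`, all `i`:
`|Δ_i(y)| ≤ C_q L^{-zα(j_m-i)}` if `i ≤ j_m`, and `|Δ_i(y)| ≤ C_q L^{-2α(i-j_m)}` if `i ≥ j_m`
("(10.51): `|q_i - q_{i+1}| ≲ 𝟙_{i≤j_m}L^{-zα(j_m-i)} + 𝟙_{i+1>j_m}L^{-2α(i-j_m)}`").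
[cite: Slade2017, Lemma 5.2.3 (proof, §10.4, display (10.51))] -/
theorem abs_cZero_massArg_sub_le (hd : 1 ≤ d) {α : ℝ} (hα0 : 0 < α) (hα2 : α < 2) (hαd : α < d)
    {L : ℝ} (hL : 2 ≤ L) :
    ∃ z : ℝ, 0 < z ∧ z * α ≤ ((d : ℝ) - α) / 2 ∧ ∃ Cq : ℝ, 0 < Cq ∧
      ∀ m2 : ℝ, 0 < m2 → m2 ≤ 1 → ∀ y : Fin d → ℝ, ∀ i : ℕ,
        (i ≤ massScale L α m2 →
          |cZero d L α y (m2 * (L ^ i) ^ α) - cZero d L α y (m2 * (L ^ (i + 1)) ^ α)| ≤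
            Cq * (L ^ (massScale L α m2 - i)) ^ (-(z * α))) ∧
        (massScale L α m2 ≤ i →
          |cZero d L α y (m2 * (L ^ i) ^ α) - cZero d L α y (m2 * (L ^ (i + 1)) ^ α)| ≤
            Cq * (L ^ (i - massScale L α m2)) ^ (-(2 * α))) := by
  have hL1 : (1 : ℝ) < L := by linarith
  have hL0 : (0 : ℝ) < L := by linarith
  obtain ⟨z₀, hz₀, C₀, hC₀, h32⟩ := Slade2017_lem1032 hd hα0 hα2 hL1.le
  have hdα : 0 < (d : ℝ) - α := by linarith
  set z : ℝ := min z₀ (((d : ℝ) - α) / (2 * α)) with hz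
  have hz0 : 0 < z := lt_min hz₀ (by positivity)
  have hzz₀ : z ≤ z₀ := min_le_left _ _
  have hzα : z * α ≤ ((d : ℝ) - α) / 2 := by
    have : z ≤ ((d : ℝ) - α) / (2 * α) := min_le_right _ _
    rw [le_div_iff₀ (by positivity)] at this
    linarith
  -- constants
  set Cq : ℝ := C₀ * ((L ^ (3 * α * z₀) + L ^ (2 * α)) * L ^ (2 * (z * α)) + L ^ (3 * (z * α)) + 1) with hCq
  have hLp : ∀ e : ℝ, 0 < L ^ e := fun e => Real.rpow_pos_of_pos hL0 e
  have hCq0 : 0 < Cq := by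
    have := hLp (3 * α * z₀); have := hLp (2 * α); have := hLp (2 * (z * α)); have := hLp (3 * (z * α))
    positivity
  refine ⟨z, hz0, hzα, Cq, hCq0, fun m2 hm hm1 y i => ?_⟩
  set J : ℕ := massScale L α m2 with hJ
  set B : ℝ := m2 * (L ^ J) ^ α with hB
  obtain ⟨hB1, hB2⟩ := massArg_massScale_bounds hL1 hα0 hm hm1
  rw [← hJ, ← hB] at hB1 hB2
  have hB0 : 0 < B := lt_of_lt_of_le (hLp α) hB1
  -- `A_i = B L^{α(i-J)}`, `A_{i+1} = B L^{α(i+1-J)}`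
  set A : ℝ := m2 * (L ^ i) ^ α with hA
  set A' : ℝ := m2 * (L ^ (i + 1)) ^ α with hA'
  have hAe : A = B * L ^ (α * ((i : ℝ) - J)) := by rw [hA, hB]; exact massArg_eq hL0 α m2 i J
  have hA'e : A' = B * L ^ (α * ((i : ℝ) + 1 - J)) := by
    rw [hA', hB, massArg_eq hL0 α m2 (i + 1) J]; push_cast; ring_nf
  have hA0 : 0 < A := by rw [hAe]; exact mul_pos hB0 (hLp _)
  have hAA' : A < A' := by
    rw [hAe, hA'e]
    refine mul_lt_mul_of_pos_left (Real.rpow_lt_rpow_of_exponent_lt hL1 ?_) hB0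
    have : α * ((i : ℝ) - J) + α = α * ((i : ℝ) + 1 - J) := by ring
    linarith
  have h := h32 y A A' hA0 hAA'
  -- generic bounds on the two indicator terms
  have hmul : ∀ a b : ℝ, L ^ a * L ^ b = L ^ (a + b) := fun a b => (Real.rpow_add hL0 a b).symm
  have hA'up : A' ≤ L ^ (α * ((i : ℝ) + 3 - J)) := by
    rw [hA'e]
    calc B * L ^ (α * ((i : ℝ) + 1 - J)) ≤ L ^ (2 * α) * L ^ (α * ((i : ℝ) + 1 - J)) :=
          mul_le_mul_of_nonneg_right hB2 (hLp _).le
      _ = L ^ (α * ((i : ℝ) + 3 - J)) := by rw [hmul]; congr 1; ring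
  have hAlow : L ^ (α * ((i : ℝ) + 1 - J)) ≤ A := by
    rw [hAe]
    calc L ^ (α * ((i : ℝ) + 1 - J)) = L ^ α * L ^ (α * ((i : ℝ) - J)) := by rw [hmul]; congr 1; ring
      _ ≤ B * L ^ (α * ((i : ℝ) - J)) := mul_le_mul_of_nonneg_right hB1 (hLp _).le
  constructor
  · intro hiJ
    have hiJ' : (i : ℝ) ≤ J := by exact_mod_cast hiJ
    -- target power as a real power: `(L^{J-i})^{-zα} = L^{-zα(J-i)}`
    have etgt : (L ^ (J - i) : ℝ) ^ (-(z * α)) = L ^ (-(z * α) * ((J : ℝ) - i)) := by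
      rw [← Real.rpow_natCast, ← Real.rpow_mul hL0.le]; congr 1; push_cast [Nat.cast_sub hiJ]; ring
    rw [etgt]
    rcases le_or_gt ((i : ℝ) + 3) J with h3 | h3
    · -- deep below the mass scale: `A' ≤ 1`, bound `C₀ A'^{z₀} ≤ C₀ A'^z ≤ C₀ L^{zα(i+3-J)}`
      have hA'1 : A' ≤ 1 := hA'up.trans (Real.rpow_le_one_of_one_le_of_nonpos hL1.le
        (mul_nonpos_of_nonneg_of_nonpos hα0.le (by linarith)))
      have hA1 : A ≤ 1 := hAA'.le.trans hA'1
      rw [if_pos hA1, if_neg (not_lt.2 hA'1), add_zero] at h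
      have hA'0 : 0 < A' := lt_trans hA0 hAA'
      calc |cZero d L α y A - cZero d L α y A'| ≤ C₀ * A' ^ z₀ := h
        _ ≤ C₀ * A' ^ z := mul_le_mul_of_nonneg_left (Real.rpow_le_rpow_of_exponent_ge hA'0 hA'1 hzz₀) hC₀.le
        _ ≤ C₀ * (L ^ (α * ((i : ℝ) + 3 - J))) ^ z :=
            mul_le_mul_of_nonneg_left (Real.rpow_le_rpow hA'0.le hA'up hz0.le) hC₀.le
        _ = C₀ * (L ^ (3 * (z * α)) * L ^ (-(z * α) * ((J : ℝ) - i))) := by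
            rw [hmul, ← Real.rpow_mul hL0.le]; congr 2; ring
        _ = C₀ * L ^ (3 * (z * α)) * L ^ (-(z * α) * ((J : ℝ) - i)) := by ring
        _ ≤ Cq * L ^ (-(z * α) * ((J : ℝ) - i)) := by
            refine mul_le_mul_of_nonneg_right ?_ (hLp _).le
            rw [hCq]
            have hX : 0 ≤ (L ^ (3 * α * z₀) + L ^ (2 * α)) * L ^ (2 * (z * α)) + 1 :=
              add_nonneg (mul_nonneg (add_nonneg (hLp _).le (hLp _).le) (hLp _).le) zero_le_one
            have h0 : 0 ≤ C₀ * ((L ^ (3 * α * z₀) + L ^ (2 * α)) * L ^ (2 * (z * α)) + 1) := mul_nonneg hC₀.le hX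
            linarith [h0]
    · -- the three scales next to the mass scale: both indicator terms are `O(1)`
      have hJ3 : J < i + 3 := by exact_mod_cast h3
      have hJi2 : (J : ℝ) ≤ i + 2 := by exact_mod_cast Nat.lt_succ_iff.1 hJ3
      have hzα0 : 0 < z * α := mul_pos hz0 hα0
      have hfirst : (if A ≤ 1 then A' ^ z₀ else 0) ≤ L ^ (3 * α * z₀) := by
        split_ifs
        · have hA'0 : 0 < A' := lt_trans hA0 hAA'
          calc A' ^ z₀ ≤ (L ^ (α * ((i : ℝ) + 3 - J))) ^ z₀ := Real.rpow_le_rpow hA'0.le hA'up hz₀.le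
            _ ≤ (L ^ (3 * α)) ^ z₀ := by
                refine Real.rpow_le_rpow (hLp _).le (Real.rpow_le_rpow_of_exponent_le hL1.le ?_) hz₀.le
                exact mul_le_three_mul hα0.le (by linarith)
            _ = L ^ (3 * α * z₀) := by rw [← Real.rpow_mul hL0.le]
        · exact (hLp _).le
      have hsecond : (if 1 < A' then (A ^ 2)⁻¹ else 0) ≤ L ^ (2 * α) := by
        split_ifs
        · have hlow : L ^ (-α) ≤ A := by
            refine le_trans (Real.rpow_le_rpow_of_exponent_le hL1.le ?_) hAlow
            exact neg_le_mul_of_neg_one_le hα0.le (by linarith)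
          calc (A ^ 2)⁻¹ ≤ ((L ^ (-α)) ^ 2)⁻¹ := by
                apply inv_anti₀ (by positivity)
                exact pow_le_pow_left₀ (hLp _).le hlow 2
            _ = L ^ (2 * α) := by
                rw [← Real.rpow_natCast, ← Real.rpow_mul hL0.le, ← Real.rpow_neg hL0.le]; congr 1; push_cast; ring
        · exact (hLp _).le
      have htgt : L ^ (-(2 * (z * α))) ≤ L ^ (-(z * α) * ((J : ℝ) - i)) := by
        apply Real.rpow_le_rpow_of_exponent_le hL1.le
        exact neg_two_mul_le hzα0.le (by linarith)
      set M : ℝ := C₀ * (L ^ (3 * α * z₀) + L ^ (2 * α)) with hM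
      have hM0 : 0 ≤ M := by positivity
      have hΔM : |cZero d L α y A - cZero d L α y A'| ≤ M :=
        h.trans (mul_le_mul_of_nonneg_left (add_le_add hfirst hsecond) hC₀.le)
      have e1 : L ^ (2 * (z * α)) * L ^ (-(2 * (z * α))) = 1 := by
        rw [hmul]; norm_num
      have hMC : M * L ^ (2 * (z * α)) ≤ Cq := by
        rw [hCq, hM]
        have h0 : 0 ≤ C₀ * (L ^ (3 * (z * α)) + 1) := mul_nonneg hC₀.le (add_nonneg (hLp _).le zero_le_one)
        have e : C₀ * (L ^ (3 * α * z₀) + L ^ (2 * α)) * L ^ (2 * (z * α)) =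
            C₀ * ((L ^ (3 * α * z₀) + L ^ (2 * α)) * L ^ (2 * (z * α))) := by ring
        rw [e]
        linarith [h0]
      calc |cZero d L α y A - cZero d L α y A'| ≤ M := hΔM
        _ = M * L ^ (2 * (z * α)) * L ^ (-(2 * (z * α))) := by rw [mul_assoc, e1, mul_one]
        _ ≤ Cq * L ^ (-(2 * (z * α))) := mul_le_mul_of_nonneg_right hMC (hLp _).le
        _ ≤ Cq * L ^ (-(z * α) * ((J : ℝ) - i)) := mul_le_mul_of_nonneg_left htgt hCq0.le
  · intro hJi
    have hJi' : (J : ℝ) ≤ i := by exact_mod_cast hJi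
    have etgt : (L ^ (i - J) : ℝ) ^ (-(2 * α)) = L ^ (-(2 * α) * ((i : ℝ) - J)) := by
      rw [← Real.rpow_natCast, ← Real.rpow_mul hL0.le]; congr 1; push_cast [Nat.cast_sub hJi]; ring
    rw [etgt]
    -- above the mass scale: `A ≥ L^α > 1`, bound `C₀ A^{-2} ≤ C₀ L^{-2α(i+1-J)}`
    have hA1 : 1 < A := by
      refine lt_of_lt_of_le ?_ hAlow
      exact Real.one_lt_rpow hL1 (mul_pos hα0 (by linarith))
    rw [if_neg (not_le.2 hA1), zero_add, if_pos (lt_trans hA1 hAA')] at h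
    calc |cZero d L α y A - cZero d L α y A'| ≤ C₀ * (A ^ 2)⁻¹ := h
      _ ≤ C₀ * ((L ^ (α * ((i : ℝ) + 1 - J))) ^ 2)⁻¹ := by
          refine mul_le_mul_of_nonneg_left (inv_anti₀ (by positivity) ?_) hC₀.le
          exact pow_le_pow_left₀ (hLp _).le hAlow 2
      _ = C₀ * (L ^ (-(2 * α)) * L ^ (-(2 * α) * ((i : ℝ) - J))) := by
          rw [hmul, ← Real.rpow_natCast, ← Real.rpow_mul hL0.le, ← Real.rpow_neg hL0.le]
          congr 2; push_cast; ring
      _ = C₀ * L ^ (-(2 * α)) * L ^ (-(2 * α) * ((i : ℝ) - J)) := by ring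
      _ ≤ Cq * L ^ (-(2 * α) * ((i : ℝ) - J)) := by
          refine mul_le_mul_of_nonneg_right ?_ (hLp _).le
          have hα2' : -(2 * α) ≤ 0 := by linarith
          have h1 : L ^ (-(2 * α)) ≤ 1 := Real.rpow_le_one_of_one_le_of_nonpos hL1.le hα2'
          have h2 : C₀ * L ^ (-(2 * α)) ≤ C₀ := mul_le_of_le_one_right hC₀.le h1
          refine h2.trans ?_
          rw [hCq]
          have hX : 0 ≤ (L ^ (3 * α * z₀) + L ^ (2 * α)) * L ^ (2 * (z * α)) + L ^ (3 * (z * α)) :=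
            add_nonneg (mul_nonneg (add_nonneg (hLp _).le (hLp _).le) (hLp _).le) (hLp _).le
          have h0 : 0 ≤ C₀ * ((L ^ (3 * α * z₀) + L ^ (2 * α)) * L ^ (2 * (z * α)) + L ^ (3 * (z * α))) :=
            mul_nonneg hC₀.le hX
          linarith [h0]

/-- The same increments for `Q(A) = ∫c₀(y,A)dy` and at `y = 0` follow at once (support in the unit
cube). [cite: Slade2017, Lemma 5.2.3 (proof, displays (10.51)–(10.53))] -/
theorem abs_integral_cZero_sub_le {A A' K : ℝ} (hd : 1 ≤ d) {α : ℝ} (hα0 : 0 < α) (hα2 : α < 2) {L : ℝ}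
    (hL : 2 ≤ L) (h : ∀ y : Fin d → ℝ, |cZero d L α y A - cZero d L α y A'| ≤ K) :
    |(∫ y : Fin d → ℝ, cZero d L α y A) - ∫ y : Fin d → ℝ, cZero d L α y A'| ≤ K := by
  have hL1 : (1 : ℝ) ≤ L := by linarith
  have hsupp : ∀ B : ℝ, Function.support (fun y : Fin d → ℝ => cZero d L α y B) ⊆
      Metric.closedBall (0 : Fin d → ℝ) (1 / 2) := by
    intro B y hy
    rw [Metric.mem_closedBall, dist_zero_right]
    by_contra h'
    refine hy (cZero_eq_zero_of_half_lt hd hα0 hα2 hL (lt_of_lt_of_le (lt_of_not_ge h') ?_) B)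
    refine (pi_norm_le_iff_of_nonneg (Finset.sum_nonneg fun i _ => abs_nonneg (y i))).2 fun i => ?_
    rw [Real.norm_eq_abs]
    exact Finset.single_le_sum (f := fun j => |y j|) (fun j _ => abs_nonneg _) (Finset.mem_univ i)
  have hint : ∀ B : ℝ, Integrable fun y : Fin d → ℝ => cZero d L α y B := by
    intro B
    obtain ⟨Lc, hLc, hlip⟩ := abs_cZero_sub_le hd hα0 hα2 hL1
    have hcont : Continuous fun y : Fin d → ℝ => cZero d L α y B := by
      have hl : LipschitzWith (Real.toNNReal Lc) (fun y : Fin d → ℝ => cZero d L α y B) :=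
        LipschitzWith.of_dist_le_mul fun y y' => by
          rw [Real.dist_eq, dist_eq_norm, Real.coe_toNNReal Lc hLc.le]; exact hlip B y y'
      exact hl.continuous
    exact (integrableOn_iff_integrable_of_support_subset (hsupp B)).1
      (hcont.continuousOn.integrableOn_compact (isCompact_closedBall 0 (1 / 2)))
  rw [← integral_sub (hint A) (hint A')]
  have hs : Function.support (fun y : Fin d → ℝ => cZero d L α y A - cZero d L α y A') ⊆
      Metric.closedBall (0 : Fin d → ℝ) (1 / 2) := by
    intro y hy
    by_contra h'
    have h1 : cZero d L α y A = 0 := Function.notMem_support.1 fun hh => h' (hsupp A hh)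
    have h2 : cZero d L α y A' = 0 := Function.notMem_support.1 fun hh => h' (hsupp A' hh)
    exact hy (by simp [h1, h2])
  rw [← setIntegral_eq_integral_of_forall_compl_eq_zero (s := Metric.closedBall (0 : Fin d → ℝ) (1 / 2))
    fun y hy => Function.notMem_support.1 fun hh => hy (hs hh)]
  have hfin : volume (Metric.closedBall (0 : Fin d → ℝ) (1 / 2)) < ⊤ := by
    rw [Real.volume_pi_closedBall _ (by norm_num)]; exact ENNReal.ofReal_lt_top
  have hb := norm_setIntegral_le_of_norm_le_const hfin (C := K) fun y _ => by
    rw [Real.norm_eq_abs]; exact h y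
  rw [Real.norm_eq_abs] at hb
  refine hb.trans ?_
  rw [Measure.real, Real.volume_pi_closedBall _ (by norm_num), ENNReal.toReal_ofReal (by positivity)]
  norm_num

end FRD

end LongRangePhi4

end Literature.Barriers.CriticalPhenomena
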